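import Mathlib.Data.Nat.Factorial.Basic
import Summits.QuantumFields.YangMills.Theorems.SmallCircleAnchorAnchorGapTreeWeightLabelling

/-!
# Crux `AnchorGap` (stmt-QuantumFields-11141), line `registered` — stub TREESUM

The registered generic stub `stub_treeWeightPolymerSum` of `Cruxes/AnchorGap/Lines/birth.lean`
(summing tree weights over the polymers through a point: the Battle–Federbush "extra `1/(n−1)!`",
the geometric bound behind the Kotecký–Preiss condition of the Gaussian cluster expansion), PROVED
from parts 1–2 (`SmallCircleAnchorAnchorGapTreeWeightPeeling.lean`,
`SmallCircleAnchorAnchorGapTreeWeightLabelling.lean`).  [folklore]; no definition, no named fact.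

* `TreeSum.factorial_mul_forestSum_le` — the RELABELLING: for any root selector `r X ∈ X`,
  `m! · Σ_{X ∋ b, #X = m+1} Σ_{t ∈ forests X {r X}} ∏_{u ≠ r X} y {u, t u}` is at most the labelled
  bound `(m+1) · (m+1)^{m−1} · Y^m` of `TreeSum.sum_labelled_le` (label `X` by `Fin (m+1)` with the
  pinned point `b` at label `0` in the `m!` possible ways, transport the tree; the relabelling is
  injective).
* `stub_treeWeightPolymerSum` — the stub, with `r X = min X` and the anchored cluster trees
  `BattleFederbush.lineSets (min X) X` bounded by the parent maps rooted at `min X`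
  (`TreeSum.lineSets_sum_le_forests_sum`).
-/

set_option autoImplicit false

namespace Summit.QuantumFields.YangMills.Theorems.AnchorGap

open Finset Function Literature.Combinatorics.Enumerative Literature.Probability.LatticeModels

namespace TreeSum

section Assembly

variable {β : Type} [Fintype β] [DecidableEq β]

/-- **The relabelling bound.** For symmetric pair weights `y ≥ 0` with row sums `≤ Y`, a pinned
point `b` and ANY root selector `r` (`r X ∈ X` whenever `b ∈ X`):
`m! · Σ_{X ∋ b, #X = m+1} Σ_{t ∈ forests X {r X}} ∏_{u ∈ X ∖ {r X}} y {u, t u}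
≤ (m+1) · (m+1)^{m−1} · Y^m`.  Each `(X, t)` is repeated once per permutation `π` of `Fin m`;
`(X, t, π) ↦ (ρ, τ, e)` — `e` the enumeration of `X` with `e 0 = b` twisted by `π`
(`exists_embed`), `τ` the transported tree (`exists_conj`), `ρ` the label of `r X` — is injective
(`eq_of_conj_eq`), preserves the summand (`prod_sdiff_eq_prod_conj`) and lands in the index set of
`sum_labelled_le` (`isForestOn_conj`). [folklore] -/
theorem factorial_mul_forestSum_le {y : Sym2 β → ℝ} (hy : ∀ ℓ, 0 ≤ y ℓ) {Y : ℝ}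
    (hY : ∀ a : β, ∑ a', y s(a, a') ≤ Y) (b : β) (m : ℕ) (r : Finset β → β)
    (hr : ∀ X : Finset β, b ∈ X → r X ∈ X) :
    ((m.factorial : ℕ) : ℝ) *
        ∑ X ∈ Finset.univ.powerset.filter (fun X : Finset β => b ∈ X ∧ X.card = m + 1),
          ∑ t ∈ forests X {r X}, ∏ u ∈ X \ {r X}, y s(u, t u)
      ≤ ((m + 1 : ℕ) : ℝ) * (((m + 1 : ℕ) : ℝ) ^ (m - 1) * Y ^ m) := by
  classical
  obtain ⟨E, hE⟩ := exists_embed b m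
  -- the index sets: polymers `P`, domain `D`, codomain `C`
  set P : Finset (Finset β) :=
    Finset.univ.powerset.filter (fun X : Finset β => b ∈ X ∧ X.card = m + 1) with hPdef
  set D : Finset ((Σ _ : Finset β, β → β) × Equiv.Perm (Fin m)) :=
    (P.sigma fun X => forests X {r X}) ×ˢ univ with hDdef
  set C : Finset (Σ _ : Fin (m + 1), (Fin (m + 1) → Fin (m + 1)) × (Fin (m + 1) → β)) :=
    (univ : Finset (Fin (m + 1))).sigma (fun ρ =>
      forests (univ : Finset (Fin (m + 1))) {ρ} ×ˢ
        Fintype.piFinset (fun i => if i ∈ (univ : Finset (Fin (m + 1))) \ {0}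
          then (univ : Finset β) else {b})) with hCdef
  have hmemP : ∀ {X : Finset β}, X ∈ P ↔ b ∈ X ∧ X.card = m + 1 := by
    intro X; simp [hPdef]
  have hmemD : ∀ {x : (Σ _ : Finset β, β → β) × Equiv.Perm (Fin m)},
      x ∈ D ↔ (b ∈ x.1.1 ∧ x.1.1.card = m + 1) ∧ IsForestOn x.1.1 {r x.1.1} x.1.2 := by
    intro x
    rw [hDdef, mem_product, Finset.mem_sigma, hmemP, mem_forests]
    simp
  -- transported trees and root labels, chosen once and for all
  have hexT : ∀ x : (Σ _ : Finset β, β → β) × Equiv.Perm (Fin m),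
      ∃ τ : Fin (m + 1) → Fin (m + 1), x ∈ D → ∀ i, E x.1.1 x.2 (τ i) = x.1.2 (E x.1.1 x.2 i) := by
    intro x
    by_cases hx : x ∈ D
    · obtain ⟨⟨hb, hc⟩, ht⟩ := hmemD.1 hx
      obtain ⟨τ, hτ⟩ := exists_conj (hE x.1.1 hb hc x.2).2.2.1 (hr _ hb) ht
      exact ⟨τ, fun _ => hτ⟩
    · exact ⟨id, fun h => absurd h hx⟩
  choose T hT using hexT
  have hexR : ∀ x : (Σ _ : Finset β, β → β) × Equiv.Perm (Fin m),
      ∃ ρ : Fin (m + 1), x ∈ D → E x.1.1 x.2 ρ = r x.1.1 := by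
    intro x
    by_cases hx : x ∈ D
    · obtain ⟨⟨hb, hc⟩, -⟩ := hmemD.1 hx
      obtain ⟨ρ, hρ⟩ := exists_index_of_mem (hE x.1.1 hb hc x.2).2.2.1 (hr _ hb)
      exact ⟨ρ, fun _ => hρ⟩
    · exact ⟨0, fun h => absurd h hx⟩
  choose Rl hRl using hexR
  -- the relabelling map `Φ` and the labelled summand `L`
  let Φ : (Σ _ : Finset β, β → β) × Equiv.Perm (Fin m) →
      (Σ _ : Fin (m + 1), (Fin (m + 1) → Fin (m + 1)) × (Fin (m + 1) → β)) :=
    fun x => ⟨Rl x, (T x, E x.1.1 x.2)⟩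
  let L : (Σ _ : Fin (m + 1), (Fin (m + 1) → Fin (m + 1)) × (Fin (m + 1) → β)) → ℝ :=
    fun z => ∏ i ∈ (univ : Finset (Fin (m + 1))) \ {z.1}, y s(z.2.2 i, z.2.2 (z.2.1 i))
  -- (1) `m! ·` the forest sum `= Σ_D` of the summand
  have h1 : ((m.factorial : ℕ) : ℝ) * ∑ X ∈ P, ∑ t ∈ forests X {r X}, ∏ u ∈ X \ {r X}, y s(u, t u)
      = ∑ x ∈ D, ∏ u ∈ x.1.1 \ {r x.1.1}, y s(u, x.1.2 u) := by
    rw [hDdef, sum_product, sum_sigma, mul_sum]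
    refine sum_congr rfl (fun X _ => ?_)
    rw [mul_sum]
    refine sum_congr rfl (fun t _ => ?_)
    dsimp only
    rw [sum_const, card_univ, Fintype.card_perm, Fintype.card_fin, nsmul_eq_mul]
  -- (2) the summand transports: `W x = L (Φ x)` on `D`
  have h2 : ∀ x ∈ D, ∏ u ∈ x.1.1 \ {r x.1.1}, y s(u, x.1.2 u) = L (Φ x) := by
    intro x hx
    obtain ⟨⟨hb, hc⟩, ht⟩ := hmemD.1 hx
    exact prod_sdiff_eq_prod_conj (hE x.1.1 hb hc x.2).2.1 (hE x.1.1 hb hc x.2).2.2.1 (hT x hx)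
      (hRl x hx) y
  -- (3) `Φ` maps `D` into `C`
  have h3 : ∀ x ∈ D, Φ x ∈ C := by
    intro x hx
    obtain ⟨⟨hb, hc⟩, ht⟩ := hmemD.1 hx
    have hEx := hE x.1.1 hb hc x.2
    rw [hCdef, Finset.mem_sigma, mem_product, mem_forests]
    refine ⟨mem_univ _, isForestOn_conj hEx.2.1 hEx.2.2.1 ht (hT x hx) (hRl x hx), ?_⟩
    rw [mem_pos]
    intro i hi
    have hi0 : i = 0 := by simpa using hi
    rw [hi0]; exact hEx.1
  -- (4) `Φ` is injective on `D`: the positions recover `X` and `π`, the tree then recovers `t`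
  have h4 : Set.InjOn Φ ↑D := by
    rintro ⟨⟨X, t⟩, π⟩ hx ⟨⟨X', t'⟩, π'⟩ hx' h
    rw [mem_coe] at hx hx'
    have hτ := hT _ hx
    have hτ' := hT _ hx'
    obtain ⟨⟨hb, hc⟩, ht⟩ := hmemD.1 hx
    obtain ⟨⟨hb', hc'⟩, ht'⟩ := hmemD.1 hx'
    simp only at hb hc ht hb' hc' ht' hτ hτ'
    simp only [Φ, Sigma.mk.injEq, heq_eq_eq, Prod.mk.injEq] at h
    obtain ⟨-, hTT, hEE⟩ := h
    have hXX : X = X' := by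
      rw [← (hE X hb hc π).2.2.1, ← (hE X' hb' hc' π').2.2.1, hEE]
    subst hXX
    have hππ : π = π' := (hE X hb hc π).2.2.2 π' hEE
    subst hππ
    have htt : t = t' :=
      eq_of_conj_eq (hE X hb hc π).2.2.1 ht ht' hτ (fun i => by rw [hTT]; exact hτ' i)
    subst htt
    rfl
  -- the chain
  rw [h1]
  calc ∑ x ∈ D, ∏ u ∈ x.1.1 \ {r x.1.1}, y s(u, x.1.2 u)
      = ∑ x ∈ D, L (Φ x) := sum_congr rfl h2
    _ = ∑ z ∈ D.image Φ, L z := (sum_image h4).symm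
    _ ≤ ∑ z ∈ C, L z := by
        refine sum_le_sum_of_subset_of_nonneg (fun z hz => ?_)
          (fun z _ _ => prod_nonneg fun _ _ => hy _)
        obtain ⟨x, hx, rfl⟩ := mem_image.1 hz
        exact h3 x hx
    _ ≤ ((m + 1 : ℕ) : ℝ) * (((m + 1 : ℕ) : ℝ) ^ (m - 1) * Y ^ m) := sum_labelled_le hy hY b m

end Assembly

end TreeSum

/-- **Stub TREESUM (GENERIC; M — summing tree weights over polymers through a point: the
Battle–Federbush "extra 1/(n−1)!"").** For non-negative pair weights with row sums `≤ Y`, the sum over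
the `n`-atom sets `X ∋ b` of the anchored-tree sums `Σ_{T ∈ lineSets(min X) X} Π_{ℓ∈T} y_ℓ` is at most
`n^{n−2}/(n−1)! · n · Y^{n−1}`.  Proof: each anchored cluster tree `T ∈ lineSets (min X) X` is the
edge set of the parent map (rooted at `min X`) of its scripts, injectively
(`TreeSum.lineSets_sum_le_forests_sum`), so the tree sum is at most the sum over the rooted forests
`t` on `X` with the root `min X` of `∏_{u ≠ min X} y {u, t u}`; label `X` by `Fin n` with the
pinned point `b` at label `0` in the `(n−1)!` possible ways and transport the tree
(`TreeSum.factorial_mul_forestSum_le`: `(n−1)! ·` forest sum `≤` labelled sum); re-root every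
labelled tree at `0` — the line product is a product over the edges of its graph, unchanged — at
the price of the factor `n` for the root label (`TreeSum.sum_forests_le_reroot`); with the root
pinned at `b`, peeling leaves gives `Σ_e ∏ ≤ Y^{n−1}` (`TreeSum.sum_pos_prod_le`); and there are
`n^{n−2}` labelled trees rooted at `0` (Cayley, `card_forests_univ_singleton`).  Hence the bound
`n^{n−2} · n · Y^{n−1} / (n−1)!`. [folklore] -/
theorem stub_treeWeightPolymerSum :
    ∀ (β : Type) [Fintype β] [DecidableEq β] [LinearOrder β] (y : Sym2 β → ℝ), (∀ ℓ : Sym2 β, 0 ≤ y ℓ) → ∀ Y : ℝ, (∀ a : β, ∑ a' : β, y s(a, a') ≤ Y) → ∀ (b : β) (n : ℕ), 2 ≤ n → ∑ X ∈ Finset.univ.powerset.filter (fun X : Finset β => b ∈ X ∧ X.card = n), (if hX : X.Nonempty then ∑ T ∈ BattleFederbush.lineSets (X.min' hX) X, ∏ ℓ ∈ T, y ℓ else 0) ≤ (n : ℝ) ^ (n - 2) / (Nat.factorial (n - 1) : ℝ) * (n : ℝ) * Y ^ (n - 1) := by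
  intro β _ _ _ y hy Y hY b n hn
  obtain ⟨m, rfl⟩ : ∃ m, n = m + 1 := ⟨n - 1, by omega⟩
  -- the root selector of the stub: the least point
  let r : Finset β → β := fun X => if hX : X.Nonempty then X.min' hX else b
  have hr : ∀ X : Finset β, b ∈ X → r X ∈ X := fun X hb => by
    have hne : X.Nonempty := ⟨b, hb⟩
    show (if hX : X.Nonempty then X.min' hX else b) ∈ X
    rw [dif_pos hne]; exact X.min'_mem hne
  -- the anchored cluster trees of each polymer inject into the parent maps rooted at `min X`
  have h1 : ∑ X ∈ Finset.univ.powerset.filter (fun X : Finset β => b ∈ X ∧ X.card = m + 1),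
        (if hX : X.Nonempty then ∑ T ∈ BattleFederbush.lineSets (X.min' hX) X, ∏ ℓ ∈ T, y ℓ else 0)
      ≤ ∑ X ∈ Finset.univ.powerset.filter (fun X : Finset β => b ∈ X ∧ X.card = m + 1),
          ∑ t ∈ forests X {r X}, ∏ u ∈ X \ {r X}, y s(u, t u) := by
    refine Finset.sum_le_sum fun X hX => ?_
    have hXne : X.Nonempty := ⟨b, (Finset.mem_filter.1 hX).2.1⟩
    rw [dif_pos hXne]
    have hroot : r X = X.min' hXne := by simp only [r, dif_pos hXne]
    rw [hroot]
    exact TreeSum.lineSets_sum_le_forests_sum hy _ _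
  -- relabel, re-root, peel, count
  have hmain := TreeSum.factorial_mul_forestSum_le hy hY b m r hr
  have hfac : (0 : ℝ) < ((m.factorial : ℕ) : ℝ) := by exact_mod_cast Nat.factorial_pos m
  have hA := (le_div_iff₀' hfac).2 hmain
  refine h1.trans (hA.trans (le_of_eq ?_))
  have e1 : m + 1 - 1 = m := by omega
  have e2 : m + 1 - 2 = m - 1 := by omega
  rw [e1, e2]
  ring

end Summit.QuantumFields.YangMills.Theorems.AnchorGap
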